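import Summits.QuantumFields.YangMills.Theorems.BalabanUVNodesN15PerCubeGreenTwoGridFineLettersOfReg335
import HarnessLib

/-!
# N15 = NE2, road (c) — PROGRAMME (PC) «[B9] Sect. C FOR THE LANDAU LETTER WITH PER-CUBE GAUGES (3.35) AS PRINTED», (PC-E) (C6-b2): THE ALL-DIRECTION STEP LETTER OF THE TRANSFORMED
# BOND VARIABLES FROM ONE `Reg335Cube` DATUM — `‖V_μ(z + e_κ) − V_μ(z)‖ ≤ η²(C∕ξ²)e^{ηC∕ξ}` for ALL `κ, μ` (the input of n15-c∕345's cell oscillation), in the gauge extended by `1` off the cube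
# (dag-n15-c g32, n15-c∕346)

Cell `pub-ymgap`, seat `pub-ymgap-dag-n15-c` (generation g32; R134 (a) seat, strategy s1 «first missing estimate»; HUMAN RULING D-0062; chair R424 venue).
`bears_on: R4∕N15 · K3⁸ SpineGivenEndpointR13SepCoPHV (stmt-QuantumFields-27366)`; filed `--kind proof --supports stmt-QuantumFields-27366 --as helper` — COUNT-NEUTRAL.
ONE theorem, 0 `def`, 0 `sorry`; bookkeeping over dag-n15-w2's landed letters (the twin of n15-c∕342 `uN_exists_gauge_pointLetters_of_reg335Cube` with the third letter in ALL directions).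
Imports BY NAME n15-c∕342 `…PerCubeGreenTwoGridFineLettersOfReg335` (through it dag-n15-w2 g5 `uN_opLetters_of_gauge335`, `uN_val_gaugeTr_eq`; r06 `Reg335Cube`).  Nothing in the tree is
modified, no landed name re-declared.

WHY.  n15-c∕345 `norm_cellOsc_le`∕`norm_cellOsc_back_le` (the oscillation letter `Ω` of n15-c∕343∕344) walk King's staircase legs in EVERY direction, so they need the step letter of
`V_μ` in every direction `κ`, not only the backward difference in direction `μ` that n15-c∕342 exported.  dag-n15-w2's `uN_opLetters_of_gauge335` HAS it (`∀ κ ν`): ★★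
`uN_exists_gauge_allLetters_of_reg335Cube` — `Reg335Cube τ U η Q ξ C` (`η > 0`) ⟹ ∃ `w` unitary everywhere with (i) `‖V_μ(z) − 1‖ ≤ η(C∕ξ)e^{ηC∕ξ}` for `z, τ_μz ∈ Q` and (ii)
`‖V_μ(τ_κz) − V_μ(z)‖ ≤ η²(C∕ξ²)e^{ηC∕ξ}` for `z, τ_κz, τ_μz, τ_μ(τ_κz) ∈ Q`, all `κ, μ` (`V_μ(z) = w(z)U_μ(z)w(τ_μz)ᴴ`).

HONEST FRAMING ∕ LIMITS.  Bookkeeping (operator norm on `M_n(ℂ)`); the class datum is the caller's; nothing of [B9] asserted ((3.35) p.396 = r06's definition).  NE2⁺ NOT PRINTED, NOT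
proved; N15 of record untouched (DISCHARGED AS CONSUMED, p687738); K3⁸ OPEN; counts of record UNMOVED (typed 28∕28 · discharged 8∕27); one finite 𝕋⁴ at fixed ε per index — NOT infinite
volume, NOT OS on ℝ⁴, NOT a mass gap, NOT Clay.  Restate-immune (no Theses import).
-/

set_option autoImplicit false

noncomputable section

open scoped BigOperators Matrix Matrix.Norms.L2Operator

namespace Summit.QuantumFields.YangMills.BalabanUVNodes.N15.CurvedSpecies

open Literature.MathematicalPhysics.QuantumFieldTheory.Balaban1983to89
open Literature.MathematicalPhysics.QuantumFieldTheory.Balaban1983to89.B9Eq3117Current (gaugeTr)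
open Literature.MathematicalPhysics.QuantumFieldTheory.Balaban1983to89.B9Eq335RegularityClasses (Reg335Cube)

variable {n : Type} [Fintype n] [DecidableEq n] [Nonempty n] {X J : Type} (τ : J → X ≃ X) (U : J → X → (Matrix n n ℂ)ˣ)

/-- ★★ **FROM THE CLASS (3.35) ON A SET: A GAUGE UNITARY EVERYWHERE WITH THE POINTWISE LETTER AND THE ALL-DIRECTION STEP LETTER OF THE TRANSFORMED BOND VARIABLES** —
`Reg335Cube τ U η Q ξ C` (`η > 0`) ⟹ ∃ `w`, `w(y)ᴴw(y) = 1` for all `y`, with `V_μ(z) = w(z)U_μ(z)w(τ_μz)ᴴ`: `‖V_μ(z) − 1‖ ≤ η(C∕ξ)e^{ηC∕ξ}` (`z, τ_μz ∈ Q`) and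
`‖V_μ(τ_κz) − V_μ(z)‖ ≤ η²(C∕ξ²)e^{ηC∕ξ}` (`z, τ_κz, τ_μz, τ_μ(τ_κz) ∈ Q`), every `κ, μ` (dag-n15-w2 `uN_opLetters_of_gauge335`, the class gauge extended by `1` off `Q`).
[cite: Balaban1985BackgroundPropagators, (3.35) p.396, Cor. 3.6 p.408] -/
theorem uN_exists_gauge_allLetters_of_reg335Cube {η : ℝ} (hη : 0 < η) {Q : Set X} {ξ C : ℝ} (h : Reg335Cube τ U η Q ξ C) :
    ∃ w : X → Matrix n n ℂ, (∀ y, (w y)ᴴ * w y = 1) ∧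
      (∀ μ z, z ∈ Q → τ μ z ∈ Q → ‖w z * (U μ z : Matrix n n ℂ) * (w (τ μ z))ᴴ - 1‖ ≤ η * ((C / ξ) * Real.exp (η * (C / ξ)))) ∧
      (∀ κ μ z, z ∈ Q → τ κ z ∈ Q → τ μ z ∈ Q → τ μ (τ κ z) ∈ Q →
        ‖w (τ κ z) * (U μ (τ κ z) : Matrix n n ℂ) * (w (τ μ (τ κ z)))ᴴ - w z * (U μ z : Matrix n n ℂ) * (w (τ μ z))ᴴ‖ ≤ η ^ 2 * ((C / ξ ^ 2) * Real.exp (η * (C / ξ)))) := by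
  classical
  obtain ⟨u, A, hu1, hg, hA, hD⟩ := h
  obtain ⟨huQ, h1, h2⟩ := uN_opLetters_of_gauge335 (T := τ) U (cube := Q) hη hu1 hg hA hD
  refine ⟨Q.piecewise (fun z => (u z : Matrix n n ℂ)) (fun _ => 1), fun y => ?_, fun μ z hz hz' => ?_, fun κ μ z hz hzκ hzμ hzκμ => ?_⟩
  · by_cases hy : y ∈ Q
    · rw [Set.piecewise_eq_of_mem _ _ _ hy]; exact Matrix.mem_unitaryGroup_iff'.mp (huQ y hy)
    · rw [Set.piecewise_eq_of_notMem _ _ _ hy, Matrix.conjTranspose_one, Matrix.mul_one]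
  · rw [Set.piecewise_eq_of_mem _ _ _ hz, Set.piecewise_eq_of_mem _ _ _ hz', ← uN_val_gaugeTr_eq (T := τ) U (huQ (τ μ z) hz')]
    exact (h1 μ z hz).trans (le_of_eq (mul_assoc _ _ _))
  · rw [Set.piecewise_eq_of_mem _ _ _ hz, Set.piecewise_eq_of_mem _ _ _ hzκ, Set.piecewise_eq_of_mem _ _ _ hzμ, Set.piecewise_eq_of_mem _ _ _ hzκμ,
      ← uN_val_gaugeTr_eq (T := τ) U (huQ (τ μ z) hzμ), ← uN_val_gaugeTr_eq (T := τ) U (huQ (τ μ (τ κ z)) hzκμ)]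
    exact (h2 κ μ z hz hzκ).trans (le_of_eq (mul_assoc _ _ _))

end Summit.QuantumFields.YangMills.BalabanUVNodes.N15.CurvedSpecies

end
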